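import Summits.Ventures.HodgeRepro2.T6N43HostFock
import Summits.Ventures.HodgeRepro2.T6N43Weights

/-!
# T6N43HostFockRec — the Fock-fixed host bundles ON THE RECORD'S WEIGHTS: `BergmanPlaces.hostFockRec`
takes the datum's three odd weights `m′_j = 2 n_j + 3`, the three twists and the three L-factors only

FILED by seat t6-p6 (gen 19, wave 1; staged gen 16 as continuation-readiness of the RS-N4.3
lane, step 3; owner file route/T6-N43-t6-p6.md §20). T6N43HostFock (gen 15; filed in WAVE 1, p438070) built
`BergmanPlaces.hostFock₁ m L₁ τ₁ ν₁ r₁ L₂ τ₂ ν₂ r₂ L₃ τ₃ ν₃ r₃` (13 explicit arguments) on the real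
carriers with the Fock model fixed and `f = φ`; T6N43Weights (gen 16; filed in WAVE 1, p437621) records the
record's
Eischen–Liu weights `(τ; ν)` at the three places from print: τ′₁ `((n₁, n₁); ())`, τ′_j `((n_j + 3);
(n_j))`, `n_j = (m′_j − 3)/2`. This file composes the two: `BergmanPlaces.hostFockRec n₁ n₂ n₃ r₁ r₂ r₃
L₁ L₂ L₃` (9 arguments: the datum's own weights `n_j` — DATA of `D`, MEMO §10.3 —, the twists `r_j` —
the lane's open print item —, and the L-factors `L_j` — re-pointed at the global datum's archimedean
factors by the M2 carrier, `withLfac`); under each of the two candidate twist readings `r_j = ±m′_j`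
the bundle has NO free choice of the lane left (`hostFockRecPlus` / `hostFockRecMinus`: 6 arguments,
all the datum's or the carrier's). The five displays the M2 statement consumes on `d43` (`hEL₁ hA2f₂
hEL₂ hA2f₃ hEL₃`) are restated on these bundles, the Eischen–Liu ones in their EVALUATED form
(explicit `Γ_ℂ`-products) — what each display ASSERTS about the datum's archimedean L-factor when the
bundle is the host inhabitant's `d43`; THEOREM N4.3 (c) follows from the five displays alone
(`hostFockRec_archNonvanishing`) and (b) at τ′₁ is the number `4` (`hostFockRec_zetaAt_zero`). Nothing
here is a toy transfer to the host datum `M` (the lead's open binder); no display is declared; nothing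
of Tiers 3–5 is re-opened. Axioms: {propext, Classical.choice, Quot.sound}.

§8(d): uses an L-value-free non-vanishing device: NO.

Filed in Tier-6 WAVE 1 as p438312 (ACCEPTED 2026-08-26T10:36:4xZ, commit b1c82dd0e675); this v2 differs from the filed
bytes in this module docstring only — the «(staged)» tags on sibling files, all filed in WAVE 1, replaced by their
filing references (the PARK release clause, STATUS l. 12943 / l. 13037 (1)); every declaration byte-identical.
-/

namespace Summit.Ventures.HodgeRepro2.T6

open MeasureTheory
open N43Weights

namespace N43Host

/-- The three real places in host shape, Fock model fixed, `f = φ`, ON THE RECORD'S WEIGHTS: the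
arguments are the datum's odd weights through `n_j = (m′_j − 3)/2`, the three twists `r_j` (open on
print) and the three archimedean L-factors `L_j` (the carrier's). -/
noncomputable def BergmanPlaces.hostFockRec (n₁ n₂ n₃ r₁ r₂ r₃ : ℤ) (L₁ L₂ L₃ : ℂ → ℂ) :
    N43Places.BergmanPlaces :=
  BergmanPlaces.hostFock₁ n₁ L₁ (tauRec₁ n₁) nuRec₁ r₁ L₂ (tauRec n₂) (nuRec n₂) r₂ L₃ (tauRec n₃)
    (nuRec n₃) r₃

/-- The weight / twist parameters of the bundle are the record's (definitional record): `m = n₁`,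
`τ₁ = (n₁, n₁)`, `(τ_j; ν_j) = ((n_j + 3); (n_j))`, `r_j` as given. -/
theorem BergmanPlaces.hostFockRec_params (n₁ n₂ n₃ r₁ r₂ r₃ : ℤ) (L₁ L₂ L₃ : ℂ → ℂ) :
    (BergmanPlaces.hostFockRec n₁ n₂ n₃ r₁ r₂ r₃ L₁ L₂ L₃).toPlaces.m = n₁ ∧
    (BergmanPlaces.hostFockRec n₁ n₂ n₃ r₁ r₂ r₃ L₁ L₂ L₃).toPlaces.τ₁ = tauRec₁ n₁ ∧
    (BergmanPlaces.hostFockRec n₁ n₂ n₃ r₁ r₂ r₃ L₁ L₂ L₃).toPlaces.ν₁ = nuRec₁ ∧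
    (BergmanPlaces.hostFockRec n₁ n₂ n₃ r₁ r₂ r₃ L₁ L₂ L₃).toPlaces.r₁ = r₁ ∧
    (BergmanPlaces.hostFockRec n₁ n₂ n₃ r₁ r₂ r₃ L₁ L₂ L₃).toPlaces.τ₂ = tauRec n₂ ∧
    (BergmanPlaces.hostFockRec n₁ n₂ n₃ r₁ r₂ r₃ L₁ L₂ L₃).toPlaces.ν₂ = nuRec n₂ ∧
    (BergmanPlaces.hostFockRec n₁ n₂ n₃ r₁ r₂ r₃ L₁ L₂ L₃).toPlaces.r₂ = r₂ ∧
    (BergmanPlaces.hostFockRec n₁ n₂ n₃ r₁ r₂ r₃ L₁ L₂ L₃).toPlaces.τ₃ = tauRec n₃ ∧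
    (BergmanPlaces.hostFockRec n₁ n₂ n₃ r₁ r₂ r₃ L₁ L₂ L₃).toPlaces.ν₃ = nuRec n₃ ∧
    (BergmanPlaces.hostFockRec n₁ n₂ n₃ r₁ r₂ r₃ L₁ L₂ L₃).toPlaces.r₃ = r₃ :=
  ⟨rfl, rfl, rfl, rfl, rfl, rfl, rfl, rfl, rfl, rfl⟩

/-- The carriers and measures of the bundle are the real ones (definitional record): `H₁ = U(2)`,
`H₂ = H₃ = U(1,1)`, `μ₁ = haarU2`, `μ₂ = μ₃ = haarU11`. -/
theorem BergmanPlaces.hostFockRec_carriers (n₁ n₂ n₃ r₁ r₂ r₃ : ℤ) (L₁ L₂ L₃ : ℂ → ℂ) :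
    (BergmanPlaces.hostFockRec n₁ n₂ n₃ r₁ r₂ r₃ L₁ L₂ L₃).toPlaces.H₁ = U2 ∧
    (BergmanPlaces.hostFockRec n₁ n₂ n₃ r₁ r₂ r₃ L₁ L₂ L₃).toPlaces.H₂ = U11 ∧
    (BergmanPlaces.hostFockRec n₁ n₂ n₃ r₁ r₂ r₃ L₁ L₂ L₃).toPlaces.H₃ = U11 ∧
    (BergmanPlaces.hostFockRec n₁ n₂ n₃ r₁ r₂ r₃ L₁ L₂ L₃).toPlaces.d₁.μ = haarU2 ∧
    (BergmanPlaces.hostFockRec n₁ n₂ n₃ r₁ r₂ r₃ L₁ L₂ L₃).toPlaces.d₂.μ = haarU11 ∧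
    (BergmanPlaces.hostFockRec n₁ n₂ n₃ r₁ r₂ r₃ L₁ L₂ L₃).toPlaces.d₃.μ = haarU11 :=
  ⟨rfl, rfl, rfl, rfl, rfl, rfl⟩

/-- THEOREM N4.3 (b) at τ′₁ on the bundle: `Z_{τ′₁}(1/2) = 4` (the Fock norms, `c₁ = 1`). -/
theorem hostFockRec_zetaAt_zero (n₁ n₂ n₃ r₁ r₂ r₃ : ℤ) (L₁ L₂ L₃ : ℂ → ℂ) :
    (BergmanPlaces.hostFockRec n₁ n₂ n₃ r₁ r₂ r₃ L₁ L₂ L₃).toPlaces.zetaAt 0 = 4 :=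
  hostFock₁_zetaAt_zero n₁ L₁ (tauRec₁ n₁) nuRec₁ r₁ L₂ (tauRec n₂) (nuRec n₂) r₂ L₃ (tauRec n₃)
    (nuRec n₃) r₃

/-- THEOREM N4.3 (c) on the bundle from the five displays alone, the displays read on the bundle's
own parameters exactly as the M2 statement reads them on `d43` (`hEL₁A hA2f₂A hEL₂A hA2f₃A hEL₃A`
with `d43 = (XA …).toPlaces`). -/
theorem hostFockRec_archNonvanishing (n₁ n₂ n₃ r₁ r₂ r₃ : ℤ) (L₁ L₂ L₃ : ℂ → ℂ)
    (hEL₁ : Hyp.EischenLiu2024_Sec2_2 2 0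
      (BergmanPlaces.hostFockRec n₁ n₂ n₃ r₁ r₂ r₃ L₁ L₂ L₃).toPlaces.τ₁
      (BergmanPlaces.hostFockRec n₁ n₂ n₃ r₁ r₂ r₃ L₁ L₂ L₃).toPlaces.ν₁
      (BergmanPlaces.hostFockRec n₁ n₂ n₃ r₁ r₂ r₃ L₁ L₂ L₃).toPlaces.r₁ L₁)
    (hA2f₂ : Hyp.Ruhl1970_A2f (BergmanPlaces.hostFockRec n₁ n₂ n₃ r₁ r₂ r₃ L₁ L₂ L₃).toPlaces.d₂)
    (hEL₂ : Hyp.EischenLiu2024_Sec2_2 1 1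
      (BergmanPlaces.hostFockRec n₁ n₂ n₃ r₁ r₂ r₃ L₁ L₂ L₃).toPlaces.τ₂
      (BergmanPlaces.hostFockRec n₁ n₂ n₃ r₁ r₂ r₃ L₁ L₂ L₃).toPlaces.ν₂
      (BergmanPlaces.hostFockRec n₁ n₂ n₃ r₁ r₂ r₃ L₁ L₂ L₃).toPlaces.r₂ L₂)
    (hA2f₃ : Hyp.Ruhl1970_A2f (BergmanPlaces.hostFockRec n₁ n₂ n₃ r₁ r₂ r₃ L₁ L₂ L₃).toPlaces.d₃)
    (hEL₃ : Hyp.EischenLiu2024_Sec2_2 1 1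
      (BergmanPlaces.hostFockRec n₁ n₂ n₃ r₁ r₂ r₃ L₁ L₂ L₃).toPlaces.τ₃
      (BergmanPlaces.hostFockRec n₁ n₂ n₃ r₁ r₂ r₃ L₁ L₂ L₃).toPlaces.ν₃
      (BergmanPlaces.hostFockRec n₁ n₂ n₃ r₁ r₂ r₃ L₁ L₂ L₃).toPlaces.r₃ L₃) :
    (BergmanPlaces.hostFockRec n₁ n₂ n₃ r₁ r₂ r₃ L₁ L₂ L₃).toPlaces.ArchNonvanishing :=
  hostFock₁_archNonvanishing n₁ L₁ (tauRec₁ n₁) nuRec₁ r₁ L₂ (tauRec n₂) (nuRec n₂) r₂ L₃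
    (tauRec n₃) (nuRec n₃) r₃ hEL₁ hA2f₂ hEL₂ hA2f₃ hEL₃

/-- What the Eischen–Liu display ASSERTS at τ′₁ when the bundle is the host inhabitant's `d43`: the
datum's archimedean L-factor there is `Γ_ℂ(s + |n₁ − r₁/2 + 1/2|) · Γ_ℂ(s + |n₁ − r₁/2 − 1/2|)`. -/
theorem hostFockRec_EL₁_iff (n₁ n₂ n₃ r₁ r₂ r₃ : ℤ) (L₁ L₂ L₃ : ℂ → ℂ) :
    Hyp.EischenLiu2024_Sec2_2 2 0
      (BergmanPlaces.hostFockRec n₁ n₂ n₃ r₁ r₂ r₃ L₁ L₂ L₃).toPlaces.τ₁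
      (BergmanPlaces.hostFockRec n₁ n₂ n₃ r₁ r₂ r₃ L₁ L₂ L₃).toPlaces.ν₁
      (BergmanPlaces.hostFockRec n₁ n₂ n₃ r₁ r₂ r₃ L₁ L₂ L₃).toPlaces.r₁ L₁ ↔
    ∀ s : ℂ, L₁ s =
      T5GammaFactor.GammaC (s + ((|(n₁ : ℝ) - (r₁ : ℝ) / 2 + 1 / 2| : ℝ) : ℂ)) *
        T5GammaFactor.GammaC (s + ((|(n₁ : ℝ) - (r₁ : ℝ) / 2 - 1 / 2| : ℝ) : ℂ)) :=
  eischenLiu_tau1_iff n₁ r₁ L₁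

/-- What the Eischen–Liu display ASSERTS at τ′₂ on the bundle: the datum's archimedean L-factor there
is `Γ_ℂ(s + |n₂ − r₂/2 + 5/2|) · Γ_ℂ(s + |n₂ − r₂/2 + 1/2|)`. -/
theorem hostFockRec_EL₂_iff (n₁ n₂ n₃ r₁ r₂ r₃ : ℤ) (L₁ L₂ L₃ : ℂ → ℂ) :
    Hyp.EischenLiu2024_Sec2_2 1 1
      (BergmanPlaces.hostFockRec n₁ n₂ n₃ r₁ r₂ r₃ L₁ L₂ L₃).toPlaces.τ₂
      (BergmanPlaces.hostFockRec n₁ n₂ n₃ r₁ r₂ r₃ L₁ L₂ L₃).toPlaces.ν₂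
      (BergmanPlaces.hostFockRec n₁ n₂ n₃ r₁ r₂ r₃ L₁ L₂ L₃).toPlaces.r₂ L₂ ↔
    ∀ s : ℂ, L₂ s =
      T5GammaFactor.GammaC (s + ((|(n₂ : ℝ) - (r₂ : ℝ) / 2 + 5 / 2| : ℝ) : ℂ)) *
        T5GammaFactor.GammaC (s + ((|(n₂ : ℝ) - (r₂ : ℝ) / 2 + 1 / 2| : ℝ) : ℂ)) :=
  eischenLiu_tauj_iff n₂ r₂ L₂

/-- What the Eischen–Liu display ASSERTS at τ′₃ on the bundle (as at τ′₂, with `n₃`, `r₃`, `L₃`). -/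
theorem hostFockRec_EL₃_iff (n₁ n₂ n₃ r₁ r₂ r₃ : ℤ) (L₁ L₂ L₃ : ℂ → ℂ) :
    Hyp.EischenLiu2024_Sec2_2 1 1
      (BergmanPlaces.hostFockRec n₁ n₂ n₃ r₁ r₂ r₃ L₁ L₂ L₃).toPlaces.τ₃
      (BergmanPlaces.hostFockRec n₁ n₂ n₃ r₁ r₂ r₃ L₁ L₂ L₃).toPlaces.ν₃
      (BergmanPlaces.hostFockRec n₁ n₂ n₃ r₁ r₂ r₃ L₁ L₂ L₃).toPlaces.r₃ L₃ ↔
    ∀ s : ℂ, L₃ s =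
      T5GammaFactor.GammaC (s + ((|(n₃ : ℝ) - (r₃ : ℝ) / 2 + 5 / 2| : ℝ) : ℂ)) *
        T5GammaFactor.GammaC (s + ((|(n₃ : ℝ) - (r₃ : ℝ) / 2 + 1 / 2| : ℝ) : ℂ)) :=
  eischenLiu_tauj_iff n₃ r₃ L₃

section TwistReadings

/-! ### The bundle under the two candidate twist readings — EVALUATED, none asserted -/

/-- Reading `r_j = +m′_j`: the bundle with no free choice of the lane left — the arguments are the
datum's weights and the carrier's L-factors. -/
noncomputable def BergmanPlaces.hostFockRecPlus (n₁ n₂ n₃ : ℤ) (L₁ L₂ L₃ : ℂ → ℂ) :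
    N43Places.BergmanPlaces :=
  BergmanPlaces.hostFockRec n₁ n₂ n₃ (mPrime n₁) (mPrime n₂) (mPrime n₃) L₁ L₂ L₃

/-- Reading `r_j = −m′_j`: the bundle with no free choice of the lane left. -/
noncomputable def BergmanPlaces.hostFockRecMinus (n₁ n₂ n₃ : ℤ) (L₁ L₂ L₃ : ℂ → ℂ) :
    N43Places.BergmanPlaces :=
  BergmanPlaces.hostFockRec n₁ n₂ n₃ (-mPrime n₁) (-mPrime n₂) (-mPrime n₃) L₁ L₂ L₃

/-- Under `r_j = +m′_j` the three Eischen–Liu displays on the bundle assert L-factors INDEPENDENT of the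
datum's weights: `L₁(s) = Γ_ℂ(s+1)Γ_ℂ(s+2)`, `L₂(s) = L₃(s) = Γ_ℂ(s+1)²`. -/
theorem hostFockRecPlus_EL_iff (n₁ n₂ n₃ : ℤ) (L₁ L₂ L₃ : ℂ → ℂ) :
    (Hyp.EischenLiu2024_Sec2_2 2 0
      (BergmanPlaces.hostFockRecPlus n₁ n₂ n₃ L₁ L₂ L₃).toPlaces.τ₁
      (BergmanPlaces.hostFockRecPlus n₁ n₂ n₃ L₁ L₂ L₃).toPlaces.ν₁
      (BergmanPlaces.hostFockRecPlus n₁ n₂ n₃ L₁ L₂ L₃).toPlaces.r₁ L₁ ↔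
      ∀ s : ℂ, L₁ s = T5GammaFactor.GammaC (s + 1) * T5GammaFactor.GammaC (s + 2)) ∧
    (Hyp.EischenLiu2024_Sec2_2 1 1
      (BergmanPlaces.hostFockRecPlus n₁ n₂ n₃ L₁ L₂ L₃).toPlaces.τ₂
      (BergmanPlaces.hostFockRecPlus n₁ n₂ n₃ L₁ L₂ L₃).toPlaces.ν₂
      (BergmanPlaces.hostFockRecPlus n₁ n₂ n₃ L₁ L₂ L₃).toPlaces.r₂ L₂ ↔
      ∀ s : ℂ, L₂ s = T5GammaFactor.GammaC (s + 1) * T5GammaFactor.GammaC (s + 1)) ∧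
    (Hyp.EischenLiu2024_Sec2_2 1 1
      (BergmanPlaces.hostFockRecPlus n₁ n₂ n₃ L₁ L₂ L₃).toPlaces.τ₃
      (BergmanPlaces.hostFockRecPlus n₁ n₂ n₃ L₁ L₂ L₃).toPlaces.ν₃
      (BergmanPlaces.hostFockRecPlus n₁ n₂ n₃ L₁ L₂ L₃).toPlaces.r₃ L₃ ↔
      ∀ s : ℂ, L₃ s = T5GammaFactor.GammaC (s + 1) * T5GammaFactor.GammaC (s + 1)) :=
  ⟨eischenLiu_tau1_twistPlus n₁ L₁, eischenLiu_tauj_twistPlus n₂ L₂, eischenLiu_tauj_twistPlus n₃ L₃⟩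

/-- Under `r_j = −m′_j` the three Eischen–Liu displays on the bundle assert
`L₁(s) = Γ_ℂ(s+|2n₁+2|)Γ_ℂ(s+|2n₁+1|)` and `L_j(s) = Γ_ℂ(s+|2n_j+4|)Γ_ℂ(s+|2n_j+2|)`, j = 2, 3. -/
theorem hostFockRecMinus_EL_iff (n₁ n₂ n₃ : ℤ) (L₁ L₂ L₃ : ℂ → ℂ) :
    (Hyp.EischenLiu2024_Sec2_2 2 0
      (BergmanPlaces.hostFockRecMinus n₁ n₂ n₃ L₁ L₂ L₃).toPlaces.τ₁
      (BergmanPlaces.hostFockRecMinus n₁ n₂ n₃ L₁ L₂ L₃).toPlaces.ν₁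
      (BergmanPlaces.hostFockRecMinus n₁ n₂ n₃ L₁ L₂ L₃).toPlaces.r₁ L₁ ↔
      ∀ s : ℂ, L₁ s =
        T5GammaFactor.GammaC (s + ((|2 * (n₁ : ℝ) + 2| : ℝ) : ℂ)) *
          T5GammaFactor.GammaC (s + ((|2 * (n₁ : ℝ) + 1| : ℝ) : ℂ))) ∧
    (Hyp.EischenLiu2024_Sec2_2 1 1
      (BergmanPlaces.hostFockRecMinus n₁ n₂ n₃ L₁ L₂ L₃).toPlaces.τ₂
      (BergmanPlaces.hostFockRecMinus n₁ n₂ n₃ L₁ L₂ L₃).toPlaces.ν₂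
      (BergmanPlaces.hostFockRecMinus n₁ n₂ n₃ L₁ L₂ L₃).toPlaces.r₂ L₂ ↔
      ∀ s : ℂ, L₂ s =
        T5GammaFactor.GammaC (s + ((|2 * (n₂ : ℝ) + 4| : ℝ) : ℂ)) *
          T5GammaFactor.GammaC (s + ((|2 * (n₂ : ℝ) + 2| : ℝ) : ℂ))) ∧
    (Hyp.EischenLiu2024_Sec2_2 1 1
      (BergmanPlaces.hostFockRecMinus n₁ n₂ n₃ L₁ L₂ L₃).toPlaces.τ₃
      (BergmanPlaces.hostFockRecMinus n₁ n₂ n₃ L₁ L₂ L₃).toPlaces.ν₃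
      (BergmanPlaces.hostFockRecMinus n₁ n₂ n₃ L₁ L₂ L₃).toPlaces.r₃ L₃ ↔
      ∀ s : ℂ, L₃ s =
        T5GammaFactor.GammaC (s + ((|2 * (n₃ : ℝ) + 4| : ℝ) : ℂ)) *
          T5GammaFactor.GammaC (s + ((|2 * (n₃ : ℝ) + 2| : ℝ) : ℂ))) :=
  ⟨eischenLiu_tau1_twistMinus n₁ L₁, eischenLiu_tauj_twistMinus n₂ L₂,
    eischenLiu_tauj_twistMinus n₃ L₃⟩

/-- THEOREM N4.3 (c) on the `+` reading from the five displays alone. -/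
theorem hostFockRecPlus_archNonvanishing (n₁ n₂ n₃ : ℤ) (L₁ L₂ L₃ : ℂ → ℂ)
    (hEL₁ : Hyp.EischenLiu2024_Sec2_2 2 0
      (BergmanPlaces.hostFockRecPlus n₁ n₂ n₃ L₁ L₂ L₃).toPlaces.τ₁
      (BergmanPlaces.hostFockRecPlus n₁ n₂ n₃ L₁ L₂ L₃).toPlaces.ν₁
      (BergmanPlaces.hostFockRecPlus n₁ n₂ n₃ L₁ L₂ L₃).toPlaces.r₁ L₁)
    (hA2f₂ : Hyp.Ruhl1970_A2f (BergmanPlaces.hostFockRecPlus n₁ n₂ n₃ L₁ L₂ L₃).toPlaces.d₂)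
    (hEL₂ : Hyp.EischenLiu2024_Sec2_2 1 1
      (BergmanPlaces.hostFockRecPlus n₁ n₂ n₃ L₁ L₂ L₃).toPlaces.τ₂
      (BergmanPlaces.hostFockRecPlus n₁ n₂ n₃ L₁ L₂ L₃).toPlaces.ν₂
      (BergmanPlaces.hostFockRecPlus n₁ n₂ n₃ L₁ L₂ L₃).toPlaces.r₂ L₂)
    (hA2f₃ : Hyp.Ruhl1970_A2f (BergmanPlaces.hostFockRecPlus n₁ n₂ n₃ L₁ L₂ L₃).toPlaces.d₃)
    (hEL₃ : Hyp.EischenLiu2024_Sec2_2 1 1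
      (BergmanPlaces.hostFockRecPlus n₁ n₂ n₃ L₁ L₂ L₃).toPlaces.τ₃
      (BergmanPlaces.hostFockRecPlus n₁ n₂ n₃ L₁ L₂ L₃).toPlaces.ν₃
      (BergmanPlaces.hostFockRecPlus n₁ n₂ n₃ L₁ L₂ L₃).toPlaces.r₃ L₃) :
    (BergmanPlaces.hostFockRecPlus n₁ n₂ n₃ L₁ L₂ L₃).toPlaces.ArchNonvanishing :=
  hostFockRec_archNonvanishing n₁ n₂ n₃ (mPrime n₁) (mPrime n₂) (mPrime n₃) L₁ L₂ L₃ hEL₁ hA2f₂ hEL₂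
    hA2f₃ hEL₃

/-- THEOREM N4.3 (c) on the `−` reading from the five displays alone. -/
theorem hostFockRecMinus_archNonvanishing (n₁ n₂ n₃ : ℤ) (L₁ L₂ L₃ : ℂ → ℂ)
    (hEL₁ : Hyp.EischenLiu2024_Sec2_2 2 0
      (BergmanPlaces.hostFockRecMinus n₁ n₂ n₃ L₁ L₂ L₃).toPlaces.τ₁
      (BergmanPlaces.hostFockRecMinus n₁ n₂ n₃ L₁ L₂ L₃).toPlaces.ν₁
      (BergmanPlaces.hostFockRecMinus n₁ n₂ n₃ L₁ L₂ L₃).toPlaces.r₁ L₁)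
    (hA2f₂ : Hyp.Ruhl1970_A2f (BergmanPlaces.hostFockRecMinus n₁ n₂ n₃ L₁ L₂ L₃).toPlaces.d₂)
    (hEL₂ : Hyp.EischenLiu2024_Sec2_2 1 1
      (BergmanPlaces.hostFockRecMinus n₁ n₂ n₃ L₁ L₂ L₃).toPlaces.τ₂
      (BergmanPlaces.hostFockRecMinus n₁ n₂ n₃ L₁ L₂ L₃).toPlaces.ν₂
      (BergmanPlaces.hostFockRecMinus n₁ n₂ n₃ L₁ L₂ L₃).toPlaces.r₂ L₂)
    (hA2f₃ : Hyp.Ruhl1970_A2f (BergmanPlaces.hostFockRecMinus n₁ n₂ n₃ L₁ L₂ L₃).toPlaces.d₃)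
    (hEL₃ : Hyp.EischenLiu2024_Sec2_2 1 1
      (BergmanPlaces.hostFockRecMinus n₁ n₂ n₃ L₁ L₂ L₃).toPlaces.τ₃
      (BergmanPlaces.hostFockRecMinus n₁ n₂ n₃ L₁ L₂ L₃).toPlaces.ν₃
      (BergmanPlaces.hostFockRecMinus n₁ n₂ n₃ L₁ L₂ L₃).toPlaces.r₃ L₃) :
    (BergmanPlaces.hostFockRecMinus n₁ n₂ n₃ L₁ L₂ L₃).toPlaces.ArchNonvanishing :=
  hostFockRec_archNonvanishing n₁ n₂ n₃ (-mPrime n₁) (-mPrime n₂) (-mPrime n₃) L₁ L₂ L₃ hEL₁ hA2f₂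
    hEL₂ hA2f₃ hEL₃

end TwistReadings

end N43Host

end Summit.Ventures.HodgeRepro2.T6
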